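import Literature.AnabelianGeometry.EtaleTheta.Discharge.Sec5Thm56OfStrvAndConnectedAllLeavesGalois
import Literature.AnabelianGeometry.EtaleTheta.Discharge.Sec5Thm56EndKnitDeltaCompat
import Literature.AnabelianGeometry.EtaleTheta.Discharge.Sec5Thm56EndKnitOfConnectedTemperoid
import HarnessLib

/-!
# [EtTh] Prop. 5.5 ⊕ Thm. 5.6 (i) K4 END KNITS at the genuine data over `B^temp(Π^tp_X)⁰` (Galois shadow PRODUCED; γ-free T56-L09c form)
# ON THE v2 SUBQUOTIENT RECORD `ThetaSubquotientProjGalois` — PROOF-ONLY, proofs verbatim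

S. Mochizuki, *The étale theta function and its Frobenioid-theoretic manifestations*, Publ. RIMS **45** (2009)
[cite: MochizukiEtTh2009, Thm 5.6 p.328–329 (PDF pp.102–103); Prop 5.5 p.327–328 (PDF pp.101–102); Cor 2.18 (i) p.286 (PDF p.60); §5 p.327 (PDF p.101) «these subquotients determine subquotients `Aut_D(D) ↠ Aut^Θ_D(D)`»].
abc-iut cell, layer L2, seat abc-iut-w6-d020 (gen 7), row «(w4-S) V1→V2 PORT — deep EndKnit*/AllLeavesV3*/KummerComparisonInputsLevel*
heads» (abc-iut-L2-lead gen 7 R957; VNEXT-CENSUS-L2 §G5 add. 11 standing row «(w4)»), layer S4a = the END KNITS `Sec5Thm56EndKnitOfConnectedTemperoid` / `Sec5Thm56EndKnitDeltaCompat` (abc-iut-w5-d013), base of the EndKnit spine.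

WHY.  abc-iut-w5-d013's END KNITS `exists_rigidityFamily_unique_preserved_ofConnectedTemperoidData_final` (Galois shadow γ PRODUCED by [SemiAnbd] Prop. 3.2, T56-L09c as a law
over the shadows) and `…_final_deltaCompat` (γ-free: the Δ-transport input = the typed predicate, here `Thm56Sub.DeltaTransportCompatGal`) bind
abc-iut-L2-t4's v1 record `(P : ThetaSubquotientProj 𝔉)` asks `proj_surjective` at EVERY base object and is EMPTY at the cell's root model for
`l` odd (abc-iut-L2-t9 p456572, kernel certificate p476337), so there each of these theorems quantifies over an empty type; abc-iut-w6-d079's v2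
record `ThetaSubquotientProjGalois 𝔉 Gal` (p481123; surjectivity only at the objects singled out by `Gal`, as print uses it — Prop. 5.1 / Lemma 5.9
run over connected GALOIS coverings) is INHABITED at every `ofSetting` carrier (p481568) and at every level stub of the junction data (p486065
`RigidData.nonempty_thetaSubquotientProjGalois_of_stub_eq_levelStub`); the v2 clauses `ThetaSubquotientProjGalois.IsKummerDetermined` /
`.CyclotomicRigidity` (p481123 / p484491) and the predicate twins `Thm56Sub.*Gal` (p484491) are the SAME formulas (they read `P` only through
`pre` / `proj` at `Base(B_N)`).

THIS FILE re-keys the listed theorems on the v2 record — binder `{Gal} (P : ThetaSubquotientProjGalois 𝔉 Gal)`, statements otherwise and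
proofs VERBATIM (none of the source arguments uses `proj_surjective`), names = the originals with suffix `_galois`: 
`exists_rigidityFamily_unique_preserved_ofConnectedTemperoidData_final_galois`, `…_final_deltaCompat_galois` — consuming this seat's twins
`exists_rigidityFamily_unique_preserved_ofConnectedTemperoidData_allLeaves_galois` (S2b) and `gammaPackage_of_baseShadow_of_deltaTransportCompat_galois` (S0) BY NAME.
0 `def`s; no v1 file is edited or restated (the `P`-free producers of the sources are consumed BY NAME); the v1 heads are the `P.toGalois Gal`
instances of these twins (abc-iut-w6-d079's `Iff.rfl` bridges `isKummerDetermined_toGalois_iff`, `cyclotomicRigidity_toGalois_iff`, `…Gal_toGalois_iff`).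

HONEST FRAMING: a typing repair of the cell's OWN record (weaker quantifier on `P`, as print uses it); kernel-checked implications between typed
statements over abc-iut-L2-t4's assembled §5 data; every named leaf / binder of the v1 heads stays NAMED exactly as there; nothing of [EtTh]
(a refereed paper) is asserted; the existence of the data for an actual curve is not claimed; typed ≠ discharged; nothing here bears on [IUTchIII]
Cor. 3.12 — no side taken; nothing here asserts abc proved or refuted.
-/

noncomputable section

namespace Literature.AnabelianGeometry.EtaleTheta

open CategoryTheory Opposite FrobenioidCyclotomicRigidity Literature.AlgebraicGeometry.Frobenioids
  Literature.AnabelianGeometry.SemiGraphs Literature.AnabelianGeometry.SemiGraphs.GaloisObjects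

universe u₀ v₀ u v w w' v₁ u₁

namespace ThetaFrobenioid

section FromSec5Thm56EndKnitOfConnectedTemperoid

variable {K : Type u₀} [Field K] {X : SemiGraphs.TemperedArithmeticGroup.{u₀} K} {D₀ : Type u₀} [Category.{v₀} D₀]
  {V : FrdIMonoidStub.{w}} {T₀ : RealifiedDivisorMonoids (D₀ := D₀) V}
  {VD : FrdICatStub.{u₀ + 1, u₀, w} (ConnectedPart (BTemp X.Pi))}
  {tf : TemperedFrobenioid T₀ (ConnectedPart (BTemp X.Pi)) VD} {hZ : tf.monoidType = MonoidType.Z}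
  {hP : ∀ A : (ConnectedPart (BTemp X.Pi))ᵒᵖ, IsPerfect (tf.Φ.carrier A)}
  {NH : Subgroup (Field.absoluteGaloisGroup K) → tf.category → ℕ+ → Prop} {A₀ : tf.category}
  {hA₀ : PreFrobenioid.IsFrobeniusTrivial tf.toElem A₀} {hA₀' : SemiGraphs.IsGaloisObj A₀.base.obj}
  {lv N : ℕ+} {l' : ℕ} {RD : RigidData.{max u₀ w} N l'}
  {pullFrac : ∀ {A A' : (BiKummerSetting.mkOfConnectedTemperoid X tf hZ hP NH A₀ hA₀ hA₀').C} (_ : A' ⟶ A),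
    (BiKummerSetting.mkOfConnectedTemperoid X tf hZ hP NH A₀ hA₀ hA₀').biratUnits A →
      (BiKummerSetting.mkOfConnectedTemperoid X tf hZ hP NH A₀ hA₀ hA₀').biratUnits A'}
  {θ : (BiKummerSetting.mkOfConnectedTemperoid X tf hZ hP NH A₀ hA₀ hA₀').biratUnits
    (BiKummerSetting.mkOfConnectedTemperoid X tf hZ hP NH A₀ hA₀ hA₀').Aodot}
  {Bl : (BiKummerSetting.mkOfConnectedTemperoid X tf hZ hP NH A₀ hA₀ hA₀').C}
  {Pl : (BiKummerSetting.mkOfConnectedTemperoid X tf hZ hP NH A₀ hA₀ hA₀').FractionPair θ Bl}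
  {Rl : (BiKummerSetting.mkOfConnectedTemperoid X tf hZ hP NH A₀ hA₀ hA₀').NthRoot θ Pl lv pullFrac}
  (h : ModelFrobenioid.Hypotheses tf.divisorMonoid tf.ratFnFunctor)
  (Q : FrobenioidTheta.ThetaSubquotientStub.{w} (ConnectedPart (BTemp X.Pi))) (odd_l : Odd (lv : ℕ))
  (R : (BiKummerSetting.mkOfConnectedTemperoid X tf hZ hP NH A₀ hA₀ hA₀').NthRoot Rl.root Rl.pair N pullFrac)
  (ιX : RD.PiX ≃ₜ* X.Pi) (K' : Type w) [Field K'] (constEmb : K'ˣ →* tf.biratUnitsModel R.BN)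
  (constEmb_injective : Function.Injective constEmb)
  (hinvc : ∀ g : Aut R.AN.base,
    pull tf.divisorMonoid g.hom (ModelFrobenioid.div R.pair.num) = ModelFrobenioid.div R.pair.num)
  (hinvp : ∀ y : RD.PiX, y ∈ RD.PiYdd →
    pull tf.divisorMonoid ((BiKummerSetting.mkOfConnectedTemperoid X tf hZ hP NH A₀ hA₀ hA₀').galoisSurj R.AN.base
      R.αData.isGalois (ιX y)).hom (ModelFrobenioid.div R.pair.den) = ModelFrobenioid.div R.pair.den)

variable {Gal : ConnectedPart (BTemp X.Pi) → Prop}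

/-- (v2 record `ThetaSubquotientProjGalois`; the v1 theorem `exists_rigidityFamily_unique_preserved_ofConnectedTemperoidData_final` VERBATIM — binder type + twin names only.) **K4 END KNIT at the genuine connected data**: [EtTh] Prop. 5.5 ⊕ Thm. 5.6 (i) for `ofConnectedTemperoidData` with the Galois
shadow PRODUCED ([SemiAnbd] Prop. 3.2, abc-iut-w5-d013), `Ψ^bs` an equivalence, and the γ-input reduced to the T56-L09c law `hT09c`.
[cite: MochizukiEtTh2009, Thm 5.6 p.328–329 (PDF pp.102–103)] -/
theorem exists_rigidityFamily_unique_preserved_ofConnectedTemperoidData_final_galois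
    -- Prop 5.5 side (η / ν pin, reachability, stub laws)
    (hB : (ofConnectedTemperoidData h Q odd_l R ιX K' constEmb constEmb_injective hinvc hinvp).IsThetaSaturated (ofConnectedTemperoidData h Q odd_l R ιX K' constEmb constEmb_injective hinvc hinvp).BN) (P : ThetaSubquotientProjGalois (ofConnectedTemperoidData h Q odd_l R ιX K' constEmb constEmb_injective hinvc hinvp) Gal)
    {η₀ : RD.PiYdd → RD.mu} (hη₀ : η₀ ∈ RD.thetaCocycles)
    (hdies : ∀ k : RD.PiYdd, rhoOfBiKummerData R ιX k = 1 → η₀ k = 1)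
    (e : RD.mu → (ofConnectedTemperoidData h Q odd_l R ιX K' constEmb constEmb_injective hinvc hinvp).lDeltaModN (ofConnectedTemperoidData h Q odd_l R ιX K' constEmb constEmb_injective hinvc hinvp).BN) (he : Function.Surjective e)
    (hpre : ∀ k : RD.PiYdd, (k : RD.PiX) ∈ RD.lDeltaTheta → rhoOfBiKummerData R ιX k ∈ P.pre _)
    (hPproj : ∀ (k : RD.PiYdd) (hk : (k : RD.PiX) ∈ RD.lDeltaTheta) (hm : rhoOfBiKummerData R ιX k ∈ P.pre _),
      (QuotientGroup.mk (P.proj _ ⟨rhoOfBiKummerData R ιX k, hm⟩) : (ofConnectedTemperoidData h Q odd_l R ιX K' constEmb constEmb_injective hinvc hinvp).lDeltaModN (ofConnectedTemperoidData h Q odd_l R ιX K' constEmb constEmb_injective hinvc hinvp).BN) = e (RD.thetaMod ⟨k, hk⟩))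
    (hcov' : ∀ g ∈ P.pre ((ofConnectedTemperoidData h Q odd_l R ιX K' constEmb constEmb_injective hinvc hinvp).base.obj (ofConnectedTemperoidData h Q odd_l R ιX K' constEmb constEmb_injective hinvc hinvp).BN), ∃ k : RD.PiYdd, (k : RD.PiX) ∈ RD.lDeltaTheta ∧ rhoOfBiKummerData R ιX k = g)
    (ν : (ofConnectedTemperoidData h Q odd_l R ιX K' constEmb constEmb_injective hinvc hinvp).lDeltaModN (ofConnectedTemperoidData h Q odd_l R ιX K' constEmb constEmb_injective hinvc hinvp).BN ≃* (ofConnectedTemperoidData h Q odd_l R ιX K' constEmb constEmb_injective hinvc hinvp).muTorsion (ofConnectedTemperoidData h Q odd_l R ιX K' constEmb constEmb_injective hinvc hinvp).BN (ofConnectedTemperoidData h Q odd_l R ιX K' constEmb constEmb_injective hinvc hinvp).N)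
    (hKν : ∀ η : (ofConnectedTemperoidData h Q odd_l R ιX K' constEmb constEmb_injective hinvc hinvp).HB → (ofConnectedTemperoidData h Q odd_l R ιX K' constEmb constEmb_injective hinvc hinvp).lDeltaModN (ofConnectedTemperoidData h Q odd_l R ιX K' constEmb constEmb_injective hinvc hinvp).BN,
      (∀ k : RD.PiYdd, η ⟨rhoOfBiKummerData R ιX k, Subgroup.mem_map_of_mem _ k.2⟩ = e (η₀ k)) →
        FrobenioidThetaBiKummer.ThetaPairKummerClass (ofConnectedTemperoidData h Q odd_l R ιX K' constEmb constEmb_injective hinvc hinvp) η ν)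
    (hgeom : P.pre R.BN.base ≤ RD.aug.ker.map (rhoOfBiKummerData R ιX))
    -- T56-L09b: Prop 3.4 (ii) constants + the origin clause «cnst kills Ker aug» (G-w5d020-2)
    {Dcnst : Type u₁} [Category.{v₁} Dcnst] {cnst : D₀ ⥤ Dcnst} (hP34 : RealifiedDivisorMonoids.Prop34Cnst T₀ cnst)
    (hΔcnst : ∀ δ ∈ RD.aug.ker,
      cnst.map (tf.base.map (rhoOfBiKummerData R ιX δ).hom) = 𝟙 (cnst.obj (tf.base.obj R.BN.base)))
    (hreach : LinearlyReachableFromBN (ofConnectedTemperoidData h Q odd_l R ιX K' constEmb constEmb_injective hinvc hinvp))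
    (hLc : Thm56Sub.LDeltaMapComp (ofConnectedTemperoidData h Q odd_l R ιX K' constEmb constEmb_injective hinvc hinvp)) (hLi : Thm56Sub.LDeltaMapId (ofConnectedTemperoidData h Q odd_l R ιX K' constEmb constEmb_injective hinvc hinvp))
    -- P55-L06 leaves: hproj named (leaf (G) `hGalT` is a THEOREM here: Galois objects of B^temp(Π)⁰ are Aut-torsors)
    (hproj : ∀ (g g' : Aut ((ofConnectedTemperoidData h Q odd_l R ιX K' constEmb constEmb_injective hinvc hinvp).base.obj (ofConnectedTemperoidData h Q odd_l R ιX K' constEmb constEmb_injective hinvc hinvp).BN)) (hh : g' ∈ P.pre _), ∃ hgh : g * g' * g⁻¹ ∈ P.pre _,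
      (ofConnectedTemperoidData h Q odd_l R ιX K' constEmb constEmb_injective hinvc hinvp).lDeltaMap g.hom (P.proj _ ⟨g', hh⟩) = P.proj _ ⟨g * g' * g⁻¹, hgh⟩)
    -- hKR (G-L6t23-3) by abc-iut-w4-d099's PIN route (p-file Sec5ThetaSectionCompatOfKummerClass): «Prop 5.2 (iii) enters ONCE» —
    -- the (η₀, ν) pin above + Facts + the cyclotome dictionary m with m ∘ ν ∘ e = id + cyclotomic-character compatibility (F-1306)
    (H : (ofConnectedTemperoidData h Q odd_l R ιX K' constEmb constEmb_injective hinvc hinvp).Facts)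
    (m : (ofConnectedTemperoidData h Q odd_l R ιX K' constEmb constEmb_injective hinvc hinvp).muTorsion (ofConnectedTemperoidData h Q odd_l R ιX K' constEmb constEmb_injective hinvc hinvp).BN (ofConnectedTemperoidData h Q odd_l R ιX K' constEmb constEmb_injective hinvc hinvp).N ≃* RD.mu)
    (hme : ∀ x : RD.mu, m (ν (e x)) = x)
    (hχX : (ofConnectedTemperoidData h Q odd_l R ιX K' constEmb constEmb_injective hinvc hinvp).CyclotomicCharacterCompatX RD.toThetaEnvData (MulEquiv.refl _) m)
    (hcovHB : ∀ k : (ofConnectedTemperoidData h Q odd_l R ιX K' constEmb constEmb_injective hinvc hinvp).HB, (k : Aut ((ofConnectedTemperoidData h Q odd_l R ιX K' constEmb constEmb_injective hinvc hinvp).base.obj (ofConnectedTemperoidData h Q odd_l R ιX K' constEmb constEmb_injective hinvc hinvp).BN)) ∈ P.pre _ →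
      ∃ (y : RD.PiX) (_ : y ∈ RD.PiYdd), (ofConnectedTemperoidData h Q odd_l R ιX K' constEmb constEmb_injective hinvc hinvp).ρ y = k ∧ y ∈ RD.lDeltaTheta)
    -- hdiff reduced to Π^tp_Ÿ ⊆ H_⊙ (`hfrac`, `haut` are THEOREMS here: [FrdI] Thm 5.2 (ii) dictionary, abc-iut-L2-t9/t4)
    (hH : ∀ y : RD.PiX, y ∈ RD.PiYdd → ιX y ∈ (BiKummerSetting.mkOfConnectedTemperoid X tf hZ hP NH A₀ hA₀ hA₀').Hodot)
    -- Thm 5.6 side: Ψ, its base shadow, Δ-transport and μ-pull data (abc-iut-L2-d4)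
    (Ψ : (BiKummerSetting.mkOfConnectedTemperoid X tf hZ hP NH A₀ hA₀ hA₀').C ≌ (BiKummerSetting.mkOfConnectedTemperoid X tf hZ hP NH A₀ hA₀ hA₀').C) (Ψbs : ConnectedPart (BTemp X.Pi) ⥤ ConnectedPart (BTemp X.Pi)) [Ψbs.IsEquivalence] (eΨ : Ψ.functor ⋙ (ofConnectedTemperoidData h Q odd_l R ιX K' constEmb constEmb_injective hinvc hinvp).base ≅ (ofConnectedTemperoidData h Q odd_l R ιX K' constEmb constEmb_injective hinvc hinvp).base ⋙ Ψbs)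
    (aΨ : ∀ A : (BiKummerSetting.mkOfConnectedTemperoid X tf hZ hP NH A₀ hA₀ hA₀').C, (ofConnectedTemperoidData h Q odd_l R ιX K' constEmb constEmb_injective hinvc hinvp).lDeltaModN A ≃* (ofConnectedTemperoidData h Q odd_l R ιX K' constEmb constEmb_injective hinvc hinvp).lDeltaModN (Ψ.functor.obj A))
    (hlin : PreFrobenioidData.PreservesMor Ψ.functor (ofConnectedTemperoidData h Q odd_l R ιX K' constEmb constEmb_injective hinvc hinvp).IsLinear (ofConnectedTemperoidData h Q odd_l R ιX K' constEmb constEmb_injective hinvc hinvp).IsLinear)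
    (haΨn : ∀ {A A' : (BiKummerSetting.mkOfConnectedTemperoid X tf hZ hP NH A₀ hA₀ hA₀').C} (φ : A ⟶ A') (x : (ofConnectedTemperoidData h Q odd_l R ιX K' constEmb constEmb_injective hinvc hinvp).lDeltaModN A),
      aΨ A' ((ofConnectedTemperoidData h Q odd_l R ιX K' constEmb constEmb_injective hinvc hinvp).lDeltaModNMap φ x) = (ofConnectedTemperoidData h Q odd_l R ιX K' constEmb constEmb_injective hinvc hinvp).lDeltaModNMap (Ψ.functor.map φ) (aΨ A x))
    (hpull : ∀ {A A' : (BiKummerSetting.mkOfConnectedTemperoid X tf hZ hP NH A₀ hA₀ hA₀').C} (φ : A ⟶ A') (u : (ofConnectedTemperoidData h Q odd_l R ιX K' constEmb constEmb_injective hinvc hinvp).muTorsion A' (ofConnectedTemperoidData h Q odd_l R ιX K' constEmb constEmb_injective hinvc hinvp).N)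
      (hu : Ψ.functor.mapAut A' (u : Aut A') ∈ (ofConnectedTemperoidData h Q odd_l R ιX K' constEmb constEmb_injective hinvc hinvp).muTorsion (Ψ.functor.obj A') (ofConnectedTemperoidData h Q odd_l R ιX K' constEmb constEmb_injective hinvc hinvp).N),
      Ψ.functor.mapAut A ((ofConnectedTemperoidData h Q odd_l R ιX K' constEmb constEmb_injective hinvc hinvp).muTorsionPull φ (ofConnectedTemperoidData h Q odd_l R ιX K' constEmb constEmb_injective hinvc hinvp).N u : Aut A) = ((ofConnectedTemperoidData h Q odd_l R ιX K' constEmb constEmb_injective hinvc hinvp).muTorsionPull (Ψ.functor.map φ) (ofConnectedTemperoidData h Q odd_l R ιX K' constEmb constEmb_injective hinvc hinvp).N ⟨_, hu⟩ : Aut (Ψ.functor.obj A)))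
    -- the NORMALISED Thm 5.7 transport (D_c = 1, e = 1: abc-iut-L2-d4 T1 + abc-iut-w5-d245 `capCupTransport_normalise`)
    (α : Ψ.functor.obj (ofConnectedTemperoidData h Q odd_l R ιX K' constEmb constEmb_injective hinvc hinvp).AN ≅ (ofConnectedTemperoidData h Q odd_l R ιX K' constEmb constEmb_injective hinvc hinvp).AN) (β : Ψ.functor.obj (ofConnectedTemperoidData h Q odd_l R ιX K' constEmb constEmb_injective hinvc hinvp).BN ≅ (ofConnectedTemperoidData h Q odd_l R ιX K' constEmb constEmb_injective hinvc hinvp).BN) {Dp₀ : Aut (ofConnectedTemperoidData h Q odd_l R ιX K' constEmb constEmb_injective hinvc hinvp).BN}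
    (hc₁ : α.inv ≫ Ψ.functor.map (ofConnectedTemperoidData h Q odd_l R ιX K' constEmb constEmb_injective hinvc hinvp).sCap ≫ β.hom = (ofConnectedTemperoidData h Q odd_l R ιX K' constEmb constEmb_injective hinvc hinvp).sCap)
    (hp₁ : α.inv ≫ Ψ.functor.map (ofConnectedTemperoidData h Q odd_l R ιX K' constEmb constEmb_injective hinvc hinvp).sCup ≫ β.hom = (ofConnectedTemperoidData h Q odd_l R ιX K' constEmb constEmb_injective hinvc hinvp).sCup ≫ Dp₀.hom) (hDp₀ : Dp₀ ∈ (ofConnectedTemperoidData h Q odd_l R ιX K' constEmb constEmb_injective hinvc hinvp).units (ofConnectedTemperoidData h Q odd_l R ιX K' constEmb constEmb_injective hinvc hinvp).BN)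
    -- [FrdI] Prop 5.6 / Thm 3.4 (iii) data at A_N (abc-iut-w5-d245's Prop 5.6 unit)
    -- the MODEL HYPOTHESES of [FrdI] Thm 3.4 (iii)/(v) at the §4 tempered Frobenioid ([EtTh] Thm 3.7 (i)(ii))
    (hD : IsOfFSMType (ConnectedPart (BTemp X.Pi))) (hslim : IsSlim (ConnectedPart (BTemp X.Pi))) (hnd : IsNonDilatingOn tf.divisorMonoid)
    (hN : ∃ A : (BiKummerSetting.mkOfConnectedTemperoid X tf hZ hP NH A₀ hA₀ hA₀').C, ¬ (PreFrobenioidData.ofModel tf.divisorMonoid tf.ratFnFunctor tf.divBNatTrans).IsGroupLikeObj A)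
    -- [EtTh] Cor 2.18 (i): the theta-related subquotients Π^tp_Ÿ, (l·Δ_Θ), … of Π^tp_X are CHARACTERISTIC (abc-iut-L2-t2's
    -- `RigidData.Cor218_i`, F-0620; discharged at the model data by abc-iut-L2-t8/L6) — supplies hP24/hγL for EVERY γ
    (h218i : RD.Cor218_i)
    -- T56-L09c ONLY (T56-L02's γ with hγ is PRODUCED by abc-iut-w5-d013's `exists_galoisShadow_cor218_ofConnectedTemperoidData`,
    -- [SemiAnbd] Prop 3.2): the Δ-transport (aΨ, β) is compatible with EVERY Galois shadow γ of every admissible base shadow θA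
    (hT09c : ∀ θA : Aut R.AN.base ≃* Aut R.AN.base,
      (∀ f : Aut R.AN, (PreFrobenioid.baseFunctor (BiKummerSetting.mkOfConnectedTemperoid X tf hZ hP NH A₀ hA₀ hA₀').F).mapIso (α.symm ≪≫ Ψ.functor.mapIso f ≪≫ α) =
        θA ((PreFrobenioid.baseFunctor (BiKummerSetting.mkOfConnectedTemperoid X tf hZ hP NH A₀ hA₀ hA₀').F).mapIso f)) →
      ∀ γ : RD.PiX ≃ₜ* RD.PiX,
        (∀ y : RD.PiX, (((ofConnectedTemperoidData h Q odd_l R ιX K' constEmb constEmb_injective hinvc hinvp).autBaseIsoAB.symm.trans θA).trans (ofConnectedTemperoidData h Q odd_l R ιX K' constEmb constEmb_injective hinvc hinvp).autBaseIsoAB) (rhoOfBiKummerData R ιX y) =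
          rhoOfBiKummerData R ιX (γ y)) →
        ∀ (k : RD.PiYdd) (hk : (k : RD.PiX) ∈ RD.lDeltaTheta) (hk' : γ k ∈ RD.lDeltaTheta),
          (ofConnectedTemperoidData h Q odd_l R ιX K' constEmb constEmb_injective hinvc hinvp).lDeltaModNMap β.hom (aΨ _ (e (RD.thetaMod ⟨k, hk⟩))) = e (RD.thetaMod ⟨γ k, hk'⟩)) :
    ∃ ρ : RigidityFamily (ofConnectedTemperoidData h Q odd_l R ιX K' constEmb constEmb_injective hinvc hinvp), ThetaSubquotientProjGalois.IsKummerDetermined (𝔉 := ofConnectedTemperoidData h Q odd_l R ιX K' constEmb constEmb_injective hinvc hinvp) P ρ hB ∧ IsFunctorialLinear (ofConnectedTemperoidData h Q odd_l R ιX K' constEmb constEmb_injective hinvc hinvp) ρ ∧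
      (∀ ρ' : RigidityFamily (ofConnectedTemperoidData h Q odd_l R ιX K' constEmb constEmb_injective hinvc hinvp), ThetaSubquotientProjGalois.IsKummerDetermined (𝔉 := ofConnectedTemperoidData h Q odd_l R ιX K' constEmb constEmb_injective hinvc hinvp) P ρ' hB → IsFunctorialLinear (ofConnectedTemperoidData h Q odd_l R ιX K' constEmb constEmb_injective hinvc hinvp) ρ' → ρ' = ρ) ∧
      CyclotomicRigidityPreserved (ofConnectedTemperoidData h Q odd_l R ιX K' constEmb constEmb_injective hinvc hinvp) Ψ ρ aΨ := by
  -- the section pair of the constructed `s^trv_N` ([FrdI] Prop 5.6, abc-iut-w5-d034 `exists_sectionPair_strvOfBiKummerData`)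
  obtain ⟨φ, hφ, hc⟩ := exists_sectionPair_strvOfBiKummerData
    (S := BiKummerSetting.mkOfConnectedTemperoid X tf hZ hP NH A₀ hA₀ hA₀') h R
  refine exists_rigidityFamily_unique_preserved_ofConnectedTemperoidData_allLeaves_galois h Q odd_l R ιX K' constEmb constEmb_injective
    hinvc hinvp hB P hη₀ hdies e he hpre hPproj hcov' ν hKν hgeom hP34 hΔcnst hreach hLc hLi hproj H m hme hχX hcovHB hH Ψ Ψbs eΨ
    aΨ hlin haΨn hpull α β hc₁ hp₁ hDp₀ φ hφ hc hD hslim hnd hN fun θA hθ => ?_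
  -- T56-L02 + Props 2.4/2.6: the Galois shadow of θA, PRODUCED (abc-iut-w5-d013, [SemiAnbd] Prop 3.2 + Cor 2.18 (i))
  obtain ⟨γ, hγ, hP24, hγL⟩ := exists_galoisShadow_cor218_ofConnectedTemperoidData h Q odd_l R ιX K' constEmb
    constEmb_injective hinvc hinvp h218i Ψ Ψbs eΨ α θA hθ
  exact ⟨γ, hγ, hP24, hγL, hT09c θA hθ γ hγ⟩

end FromSec5Thm56EndKnitOfConnectedTemperoid

section FromSec5Thm56EndKnitDeltaCompat

variable {K : Type u₀} [Field K] {X : SemiGraphs.TemperedArithmeticGroup.{u₀} K} {D₀ : Type u₀} [Category.{v₀} D₀]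
  {V : FrdIMonoidStub.{w}} {T₀ : RealifiedDivisorMonoids (D₀ := D₀) V}
  {VD : FrdICatStub.{u₀ + 1, u₀, w} (ConnectedPart (BTemp X.Pi))}
  {tf : TemperedFrobenioid T₀ (ConnectedPart (BTemp X.Pi)) VD} {hZ : tf.monoidType = MonoidType.Z}
  {hP : ∀ A : (ConnectedPart (BTemp X.Pi))ᵒᵖ, IsPerfect (tf.Φ.carrier A)}
  {NH : Subgroup (Field.absoluteGaloisGroup K) → tf.category → ℕ+ → Prop} {A₀ : tf.category}
  {hA₀ : PreFrobenioid.IsFrobeniusTrivial tf.toElem A₀} {hA₀' : SemiGraphs.IsGaloisObj A₀.base.obj}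
  {lv N : ℕ+} {l' : ℕ} {RD : RigidData.{max u₀ w} N l'}
  {pullFrac : ∀ {A A' : (BiKummerSetting.mkOfConnectedTemperoid X tf hZ hP NH A₀ hA₀ hA₀').C} (_ : A' ⟶ A),
    (BiKummerSetting.mkOfConnectedTemperoid X tf hZ hP NH A₀ hA₀ hA₀').biratUnits A →
      (BiKummerSetting.mkOfConnectedTemperoid X tf hZ hP NH A₀ hA₀ hA₀').biratUnits A'}
  {θ : (BiKummerSetting.mkOfConnectedTemperoid X tf hZ hP NH A₀ hA₀ hA₀').biratUnits
    (BiKummerSetting.mkOfConnectedTemperoid X tf hZ hP NH A₀ hA₀ hA₀').Aodot}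
  {Bl : (BiKummerSetting.mkOfConnectedTemperoid X tf hZ hP NH A₀ hA₀ hA₀').C}
  {Pl : (BiKummerSetting.mkOfConnectedTemperoid X tf hZ hP NH A₀ hA₀ hA₀').FractionPair θ Bl}
  {Rl : (BiKummerSetting.mkOfConnectedTemperoid X tf hZ hP NH A₀ hA₀ hA₀').NthRoot θ Pl lv pullFrac}
  (h : ModelFrobenioid.Hypotheses tf.divisorMonoid tf.ratFnFunctor)
  (Q : FrobenioidTheta.ThetaSubquotientStub.{w} (ConnectedPart (BTemp X.Pi))) (odd_l : Odd (lv : ℕ))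
  (R : (BiKummerSetting.mkOfConnectedTemperoid X tf hZ hP NH A₀ hA₀ hA₀').NthRoot Rl.root Rl.pair N pullFrac)
  (ιX : RD.PiX ≃ₜ* X.Pi) (K' : Type w) [Field K'] (constEmb : K'ˣ →* tf.biratUnitsModel R.BN)
  (constEmb_injective : Function.Injective constEmb)
  (hinvc : ∀ g : Aut R.AN.base,
    pull tf.divisorMonoid g.hom (ModelFrobenioid.div R.pair.num) = ModelFrobenioid.div R.pair.num)
  (hinvp : ∀ y : RD.PiX, y ∈ RD.PiYdd →
    pull tf.divisorMonoid ((BiKummerSetting.mkOfConnectedTemperoid X tf hZ hP NH A₀ hA₀ hA₀').galoisSurj R.AN.base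
      R.αData.isGalois (ιX y)).hom (ModelFrobenioid.div R.pair.den) = ModelFrobenioid.div R.pair.den)

variable {Gal : ConnectedPart (BTemp X.Pi) → Prop}

/-- (v2 record `ThetaSubquotientProjGalois`; the v1 theorem `exists_rigidityFamily_unique_preserved_ofConnectedTemperoidData_final_deltaCompat` VERBATIM — binder type + twin names only.) **K4 END KNIT at the genuine connected data, γ-free form**: [EtTh] Prop. 5.5 ⊕ Thm. 5.6 (i) for `ofConnectedTemperoidData` with the
Galois shadow PRODUCED ([SemiAnbd] Prop. 3.2, abc-iut-w5-d013), `Ψ^bs` an equivalence, and the Δ-transport input = the typed T56-L09c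
predicate `Thm56Sub.DeltaTransportCompatGal` for every admissible base shadow.
[cite: MochizukiEtTh2009, Thm 5.6 p.328–329 (PDF pp.102–103)] -/
theorem exists_rigidityFamily_unique_preserved_ofConnectedTemperoidData_final_deltaCompat_galois
    -- Prop 5.5 side (η / ν pin, reachability, stub laws)
    (hB : (ofConnectedTemperoidData h Q odd_l R ιX K' constEmb constEmb_injective hinvc hinvp).IsThetaSaturated (ofConnectedTemperoidData h Q odd_l R ιX K' constEmb constEmb_injective hinvc hinvp).BN) (P : ThetaSubquotientProjGalois (ofConnectedTemperoidData h Q odd_l R ιX K' constEmb constEmb_injective hinvc hinvp) Gal)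
    {η₀ : RD.PiYdd → RD.mu} (hη₀ : η₀ ∈ RD.thetaCocycles)
    (hdies : ∀ k : RD.PiYdd, rhoOfBiKummerData R ιX k = 1 → η₀ k = 1)
    (e : RD.mu → (ofConnectedTemperoidData h Q odd_l R ιX K' constEmb constEmb_injective hinvc hinvp).lDeltaModN (ofConnectedTemperoidData h Q odd_l R ιX K' constEmb constEmb_injective hinvc hinvp).BN) (he : Function.Surjective e)
    (hpre : ∀ k : RD.PiYdd, (k : RD.PiX) ∈ RD.lDeltaTheta → rhoOfBiKummerData R ιX k ∈ P.pre _)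
    (hPproj : ∀ (k : RD.PiYdd) (hk : (k : RD.PiX) ∈ RD.lDeltaTheta) (hm : rhoOfBiKummerData R ιX k ∈ P.pre _),
      (QuotientGroup.mk (P.proj _ ⟨rhoOfBiKummerData R ιX k, hm⟩) : (ofConnectedTemperoidData h Q odd_l R ιX K' constEmb constEmb_injective hinvc hinvp).lDeltaModN (ofConnectedTemperoidData h Q odd_l R ιX K' constEmb constEmb_injective hinvc hinvp).BN) = e (RD.thetaMod ⟨k, hk⟩))
    (hcov' : ∀ g ∈ P.pre ((ofConnectedTemperoidData h Q odd_l R ιX K' constEmb constEmb_injective hinvc hinvp).base.obj (ofConnectedTemperoidData h Q odd_l R ιX K' constEmb constEmb_injective hinvc hinvp).BN), ∃ k : RD.PiYdd, (k : RD.PiX) ∈ RD.lDeltaTheta ∧ rhoOfBiKummerData R ιX k = g)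
    (ν : (ofConnectedTemperoidData h Q odd_l R ιX K' constEmb constEmb_injective hinvc hinvp).lDeltaModN (ofConnectedTemperoidData h Q odd_l R ιX K' constEmb constEmb_injective hinvc hinvp).BN ≃* (ofConnectedTemperoidData h Q odd_l R ιX K' constEmb constEmb_injective hinvc hinvp).muTorsion (ofConnectedTemperoidData h Q odd_l R ιX K' constEmb constEmb_injective hinvc hinvp).BN (ofConnectedTemperoidData h Q odd_l R ιX K' constEmb constEmb_injective hinvc hinvp).N)
    (hKν : ∀ η : (ofConnectedTemperoidData h Q odd_l R ιX K' constEmb constEmb_injective hinvc hinvp).HB → (ofConnectedTemperoidData h Q odd_l R ιX K' constEmb constEmb_injective hinvc hinvp).lDeltaModN (ofConnectedTemperoidData h Q odd_l R ιX K' constEmb constEmb_injective hinvc hinvp).BN,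
      (∀ k : RD.PiYdd, η ⟨rhoOfBiKummerData R ιX k, Subgroup.mem_map_of_mem _ k.2⟩ = e (η₀ k)) →
        FrobenioidThetaBiKummer.ThetaPairKummerClass (ofConnectedTemperoidData h Q odd_l R ιX K' constEmb constEmb_injective hinvc hinvp) η ν)
    (hgeom : P.pre R.BN.base ≤ RD.aug.ker.map (rhoOfBiKummerData R ιX))
    -- T56-L09b: Prop 3.4 (ii) constants + the origin clause «cnst kills Ker aug» (G-w5d020-2)
    {Dcnst : Type u₁} [Category.{v₁} Dcnst] {cnst : D₀ ⥤ Dcnst} (hP34 : RealifiedDivisorMonoids.Prop34Cnst T₀ cnst)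
    (hΔcnst : ∀ δ ∈ RD.aug.ker,
      cnst.map (tf.base.map (rhoOfBiKummerData R ιX δ).hom) = 𝟙 (cnst.obj (tf.base.obj R.BN.base)))
    (hreach : LinearlyReachableFromBN (ofConnectedTemperoidData h Q odd_l R ιX K' constEmb constEmb_injective hinvc hinvp))
    (hLc : Thm56Sub.LDeltaMapComp (ofConnectedTemperoidData h Q odd_l R ιX K' constEmb constEmb_injective hinvc hinvp)) (hLi : Thm56Sub.LDeltaMapId (ofConnectedTemperoidData h Q odd_l R ιX K' constEmb constEmb_injective hinvc hinvp))
    -- P55-L06 leaves: hproj named (leaf (G) `hGalT` is a THEOREM here: Galois objects of B^temp(Π)⁰ are Aut-torsors)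
    (hproj : ∀ (g g' : Aut ((ofConnectedTemperoidData h Q odd_l R ιX K' constEmb constEmb_injective hinvc hinvp).base.obj (ofConnectedTemperoidData h Q odd_l R ιX K' constEmb constEmb_injective hinvc hinvp).BN)) (hh : g' ∈ P.pre _), ∃ hgh : g * g' * g⁻¹ ∈ P.pre _,
      (ofConnectedTemperoidData h Q odd_l R ιX K' constEmb constEmb_injective hinvc hinvp).lDeltaMap g.hom (P.proj _ ⟨g', hh⟩) = P.proj _ ⟨g * g' * g⁻¹, hgh⟩)
    -- hKR (G-L6t23-3) by abc-iut-w4-d099's PIN route (p-file Sec5ThetaSectionCompatOfKummerClass): «Prop 5.2 (iii) enters ONCE» —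
    -- the (η₀, ν) pin above + Facts + the cyclotome dictionary m with m ∘ ν ∘ e = id + cyclotomic-character compatibility (F-1306)
    (H : (ofConnectedTemperoidData h Q odd_l R ιX K' constEmb constEmb_injective hinvc hinvp).Facts)
    (m : (ofConnectedTemperoidData h Q odd_l R ιX K' constEmb constEmb_injective hinvc hinvp).muTorsion (ofConnectedTemperoidData h Q odd_l R ιX K' constEmb constEmb_injective hinvc hinvp).BN (ofConnectedTemperoidData h Q odd_l R ιX K' constEmb constEmb_injective hinvc hinvp).N ≃* RD.mu)
    (hme : ∀ x : RD.mu, m (ν (e x)) = x)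
    (hχX : (ofConnectedTemperoidData h Q odd_l R ιX K' constEmb constEmb_injective hinvc hinvp).CyclotomicCharacterCompatX RD.toThetaEnvData (MulEquiv.refl _) m)
    (hcovHB : ∀ k : (ofConnectedTemperoidData h Q odd_l R ιX K' constEmb constEmb_injective hinvc hinvp).HB, (k : Aut ((ofConnectedTemperoidData h Q odd_l R ιX K' constEmb constEmb_injective hinvc hinvp).base.obj (ofConnectedTemperoidData h Q odd_l R ιX K' constEmb constEmb_injective hinvc hinvp).BN)) ∈ P.pre _ →
      ∃ (y : RD.PiX) (_ : y ∈ RD.PiYdd), (ofConnectedTemperoidData h Q odd_l R ιX K' constEmb constEmb_injective hinvc hinvp).ρ y = k ∧ y ∈ RD.lDeltaTheta)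
    -- hdiff reduced to Π^tp_Ÿ ⊆ H_⊙ (`hfrac`, `haut` are THEOREMS here: [FrdI] Thm 5.2 (ii) dictionary, abc-iut-L2-t9/t4)
    (hH : ∀ y : RD.PiX, y ∈ RD.PiYdd → ιX y ∈ (BiKummerSetting.mkOfConnectedTemperoid X tf hZ hP NH A₀ hA₀ hA₀').Hodot)
    -- Thm 5.6 side: Ψ, its base shadow, Δ-transport and μ-pull data (abc-iut-L2-d4)
    (Ψ : (BiKummerSetting.mkOfConnectedTemperoid X tf hZ hP NH A₀ hA₀ hA₀').C ≌ (BiKummerSetting.mkOfConnectedTemperoid X tf hZ hP NH A₀ hA₀ hA₀').C) (Ψbs : ConnectedPart (BTemp X.Pi) ⥤ ConnectedPart (BTemp X.Pi)) [Ψbs.IsEquivalence] (eΨ : Ψ.functor ⋙ (ofConnectedTemperoidData h Q odd_l R ιX K' constEmb constEmb_injective hinvc hinvp).base ≅ (ofConnectedTemperoidData h Q odd_l R ιX K' constEmb constEmb_injective hinvc hinvp).base ⋙ Ψbs)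
    (aΨ : ∀ A : (BiKummerSetting.mkOfConnectedTemperoid X tf hZ hP NH A₀ hA₀ hA₀').C, (ofConnectedTemperoidData h Q odd_l R ιX K' constEmb constEmb_injective hinvc hinvp).lDeltaModN A ≃* (ofConnectedTemperoidData h Q odd_l R ιX K' constEmb constEmb_injective hinvc hinvp).lDeltaModN (Ψ.functor.obj A))
    (hlin : PreFrobenioidData.PreservesMor Ψ.functor (ofConnectedTemperoidData h Q odd_l R ιX K' constEmb constEmb_injective hinvc hinvp).IsLinear (ofConnectedTemperoidData h Q odd_l R ιX K' constEmb constEmb_injective hinvc hinvp).IsLinear)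
    (haΨn : ∀ {A A' : (BiKummerSetting.mkOfConnectedTemperoid X tf hZ hP NH A₀ hA₀ hA₀').C} (φ : A ⟶ A') (x : (ofConnectedTemperoidData h Q odd_l R ιX K' constEmb constEmb_injective hinvc hinvp).lDeltaModN A),
      aΨ A' ((ofConnectedTemperoidData h Q odd_l R ιX K' constEmb constEmb_injective hinvc hinvp).lDeltaModNMap φ x) = (ofConnectedTemperoidData h Q odd_l R ιX K' constEmb constEmb_injective hinvc hinvp).lDeltaModNMap (Ψ.functor.map φ) (aΨ A x))
    (hpull : ∀ {A A' : (BiKummerSetting.mkOfConnectedTemperoid X tf hZ hP NH A₀ hA₀ hA₀').C} (φ : A ⟶ A') (u : (ofConnectedTemperoidData h Q odd_l R ιX K' constEmb constEmb_injective hinvc hinvp).muTorsion A' (ofConnectedTemperoidData h Q odd_l R ιX K' constEmb constEmb_injective hinvc hinvp).N)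
      (hu : Ψ.functor.mapAut A' (u : Aut A') ∈ (ofConnectedTemperoidData h Q odd_l R ιX K' constEmb constEmb_injective hinvc hinvp).muTorsion (Ψ.functor.obj A') (ofConnectedTemperoidData h Q odd_l R ιX K' constEmb constEmb_injective hinvc hinvp).N),
      Ψ.functor.mapAut A ((ofConnectedTemperoidData h Q odd_l R ιX K' constEmb constEmb_injective hinvc hinvp).muTorsionPull φ (ofConnectedTemperoidData h Q odd_l R ιX K' constEmb constEmb_injective hinvc hinvp).N u : Aut A) = ((ofConnectedTemperoidData h Q odd_l R ιX K' constEmb constEmb_injective hinvc hinvp).muTorsionPull (Ψ.functor.map φ) (ofConnectedTemperoidData h Q odd_l R ιX K' constEmb constEmb_injective hinvc hinvp).N ⟨_, hu⟩ : Aut (Ψ.functor.obj A)))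
    -- the NORMALISED Thm 5.7 transport (D_c = 1, e = 1: abc-iut-L2-d4 T1 + abc-iut-w5-d245 `capCupTransport_normalise`)
    (α : Ψ.functor.obj (ofConnectedTemperoidData h Q odd_l R ιX K' constEmb constEmb_injective hinvc hinvp).AN ≅ (ofConnectedTemperoidData h Q odd_l R ιX K' constEmb constEmb_injective hinvc hinvp).AN) (β : Ψ.functor.obj (ofConnectedTemperoidData h Q odd_l R ιX K' constEmb constEmb_injective hinvc hinvp).BN ≅ (ofConnectedTemperoidData h Q odd_l R ιX K' constEmb constEmb_injective hinvc hinvp).BN) {Dp₀ : Aut (ofConnectedTemperoidData h Q odd_l R ιX K' constEmb constEmb_injective hinvc hinvp).BN}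
    (hc₁ : α.inv ≫ Ψ.functor.map (ofConnectedTemperoidData h Q odd_l R ιX K' constEmb constEmb_injective hinvc hinvp).sCap ≫ β.hom = (ofConnectedTemperoidData h Q odd_l R ιX K' constEmb constEmb_injective hinvc hinvp).sCap)
    (hp₁ : α.inv ≫ Ψ.functor.map (ofConnectedTemperoidData h Q odd_l R ιX K' constEmb constEmb_injective hinvc hinvp).sCup ≫ β.hom = (ofConnectedTemperoidData h Q odd_l R ιX K' constEmb constEmb_injective hinvc hinvp).sCup ≫ Dp₀.hom) (hDp₀ : Dp₀ ∈ (ofConnectedTemperoidData h Q odd_l R ιX K' constEmb constEmb_injective hinvc hinvp).units (ofConnectedTemperoidData h Q odd_l R ιX K' constEmb constEmb_injective hinvc hinvp).BN)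
    -- [FrdI] Prop 5.6 / Thm 3.4 (iii) data at A_N (abc-iut-w5-d245's Prop 5.6 unit)
    -- the MODEL HYPOTHESES of [FrdI] Thm 3.4 (iii)/(v) at the §4 tempered Frobenioid ([EtTh] Thm 3.7 (i)(ii))
    (hD : IsOfFSMType (ConnectedPart (BTemp X.Pi))) (hslim : IsSlim (ConnectedPart (BTemp X.Pi))) (hnd : IsNonDilatingOn tf.divisorMonoid)
    (hN : ∃ A : (BiKummerSetting.mkOfConnectedTemperoid X tf hZ hP NH A₀ hA₀ hA₀').C, ¬ (PreFrobenioidData.ofModel tf.divisorMonoid tf.ratFnFunctor tf.divBNatTrans).IsGroupLikeObj A)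
    -- [EtTh] Cor 2.18 (i): the theta-related subquotients Π^tp_Ÿ, (l·Δ_Θ), … of Π^tp_X are CHARACTERISTIC (abc-iut-L2-t2's
    -- `RigidData.Cor218_i`, F-0620; discharged at the model data by abc-iut-L2-t8/L6) — supplies hP24/hγL for EVERY γ
    (h218i : RD.Cor218_i)
    -- T56-L09c in its γ-FREE typed form (abc-iut-w5-d020's `Thm56Sub.DeltaTransportCompatGal`): at B_N the Δ-transport (aΨ, β)
    -- agrees on P.pre with the map induced by the B_N-transport θ′ of every admissible base shadow θA (no γ mentioned)
    (hΔ : ∀ θA : Aut R.AN.base ≃* Aut R.AN.base,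
      (∀ f : Aut R.AN, (PreFrobenioid.baseFunctor (BiKummerSetting.mkOfConnectedTemperoid X tf hZ hP NH A₀ hA₀ hA₀').F).mapIso (α.symm ≪≫ Ψ.functor.mapIso f ≪≫ α) =
        θA ((PreFrobenioid.baseFunctor (BiKummerSetting.mkOfConnectedTemperoid X tf hZ hP NH A₀ hA₀ hA₀').F).mapIso f)) →
      Thm56Sub.DeltaTransportCompatGal (ofConnectedTemperoidData h Q odd_l R ιX K' constEmb constEmb_injective hinvc hinvp) Ψ β aΨ (((ofConnectedTemperoidData h Q odd_l R ιX K' constEmb constEmb_injective hinvc hinvp).autBaseIsoAB.symm.trans θA).trans (ofConnectedTemperoidData h Q odd_l R ιX K' constEmb constEmb_injective hinvc hinvp).autBaseIsoAB) P) :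
    ∃ ρ : RigidityFamily (ofConnectedTemperoidData h Q odd_l R ιX K' constEmb constEmb_injective hinvc hinvp), ThetaSubquotientProjGalois.IsKummerDetermined (𝔉 := ofConnectedTemperoidData h Q odd_l R ιX K' constEmb constEmb_injective hinvc hinvp) P ρ hB ∧ IsFunctorialLinear (ofConnectedTemperoidData h Q odd_l R ιX K' constEmb constEmb_injective hinvc hinvp) ρ ∧
      (∀ ρ' : RigidityFamily (ofConnectedTemperoidData h Q odd_l R ιX K' constEmb constEmb_injective hinvc hinvp), ThetaSubquotientProjGalois.IsKummerDetermined (𝔉 := ofConnectedTemperoidData h Q odd_l R ιX K' constEmb constEmb_injective hinvc hinvp) P ρ' hB → IsFunctorialLinear (ofConnectedTemperoidData h Q odd_l R ιX K' constEmb constEmb_injective hinvc hinvp) ρ' → ρ' = ρ) ∧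
      CyclotomicRigidityPreserved (ofConnectedTemperoidData h Q odd_l R ιX K' constEmb constEmb_injective hinvc hinvp) Ψ ρ aΨ := by
  -- the section pair of the constructed `s^trv_N` ([FrdI] Prop 5.6, abc-iut-w5-d034 `exists_sectionPair_strvOfBiKummerData`)
  obtain ⟨φ, hφ, hc⟩ := exists_sectionPair_strvOfBiKummerData
    (S := BiKummerSetting.mkOfConnectedTemperoid X tf hZ hP NH A₀ hA₀ hA₀') h R
  -- the FULL γ-package hΓ from the γ-free compatibility (abc-iut-w5-d013: [SemiAnbd] Prop 3.2 shadow + Cor 2.18 (i) + hpre/hP)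
  have hΓ := gammaPackage_of_baseShadow_of_deltaTransportCompat_galois h _ Q odd_l R ιX _ _ K' constEmb constEmb_injective _ _
    (fun _ hA => ⟨hA, fun _ => rfl⟩) (baseMap_strvOfBiKummerData h R) h218i Ψ Ψbs eΨ α e P hpre hPproj β aΨ hΔ
  exact exists_rigidityFamily_unique_preserved_ofConnectedTemperoidData_allLeaves_galois h Q odd_l R ιX K' constEmb constEmb_injective
    hinvc hinvp hB P hη₀ hdies e he hpre hPproj hcov' ν hKν hgeom hP34 hΔcnst hreach hLc hLi hproj H m hme hχX hcovHB hH Ψ Ψbs eΨ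
    aΨ hlin haΨn hpull α β hc₁ hp₁ hDp₀ φ hφ hc hD hslim hnd hN hΓ

end FromSec5Thm56EndKnitDeltaCompat

end ThetaFrobenioid

end Literature.AnabelianGeometry.EtaleTheta

end
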